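import Mathlib
import HarnessLib
import Literature.MathematicalPhysics.StatisticalMechanics.WeightDataABKMDominated

/-!
# The scale parameters `h_k`, `𝔥_k`, `g_k` of [ABKM19] and the threshold `h₀(L)`
# ((6.39)–(6.40), (7.6), (7.60), (7.62), Lemma 7.8 (7.87))

Bookkeeping for the consumers of Theorem 7.1 (w6'), (w9) on the torus
(`WeightStrongStepABKM.pert_sub_two_smul_strong_posSemidef`,
`WeightFieldNormABKM.fieldGauge_sq_le_pert`, the `strong` clause of `AbkmWeightBounds`): with
`h_k = 2^k h` (`hScale`), the field-norm unit `𝔥_k = h_k L^{-k(d-2)/2}` (`fieldWt`, the weight of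
`fieldGauge` at scale `k`, so that `𝔥_k² (L^k)^{d-2} = h_k²`), the strong coefficient
`g_k = h_k^{-2}` for `k ≤ N` and `0` beyond (`strongCoef`), and the schedule
`δ'_k = schedDelta δ₀ δ₁ N k` (`δ₀` at `k = 0`, `δ₁4^{-k}` for `1 ≤ k ≤ N`), ONE lower bound
`h² ≥ h₀² := max(θ_max/δ₀, max(2^{d+3}θ_max², 8^dθ_max)/δ₁)` (`hZeroSq`, independent of `N`)
gives, for all scales at once:
* `strongCoef_le` — `g_k ≤ δ'_k/θ_max` ((7.60), the admissibility of the strong forms);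
* `strong_step_cond` — `2^{d+1} g_k θ_max² ≤ δ'_{k+1}` for `k + 1 ≤ N` ((7.62), input of (w6'));
* `field_norm_cond` — `8^d θ_max ≤ δ'_{k+1} 𝔥_{k+1}² (L^{k+1})^{d-2}` for `k + 1 ≤ N` ((7.87), input
  of Lemma 7.8 / (w9)).

Everything is proved; no named fact.

## References
* S. Adams, S. Buchholz, R. Kotecký, S. Müller, arXiv:1910.13564, (6.39)–(6.40), (7.6), (7.60),
  (7.62), (7.87), Theorem 7.1 (`h ≥ h₀(L)`) [AdamsBuchholzKoteckyMuller2019].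
-/

noncomputable section

namespace Literature.MathematicalPhysics.StatisticalMechanics.GradientRG

open Real

/-- `h_k = 2^k h`. [cite: AdamsBuchholzKoteckyMuller2019, (6.39)] -/
def hScale (h : ℝ) (k : ℕ) : ℝ := 2 ^ k * h

/-- `𝔥_k = h_k L^{-k(d-2)/2}`, the field-norm unit at scale `k` in the convention of `fieldGauge`
(`|φ|_{k,X} = 𝔥_k⁻¹ sup L^{k|α|}|∇^αφ|`). [cite: AdamsBuchholzKoteckyMuller2019, (6.40)] -/
def fieldWt (h L : ℝ) (d k : ℕ) : ℝ := hScale h k / Real.sqrt (L ^ (k * (d - 2)))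

/-- `g_k = h_k^{-2}` for `k ≤ N` (and `0` for the unused scales `k > N`), the coefficient of the
strong form `G_k^X = g_k M(1_X)`. [cite: AdamsBuchholzKoteckyMuller2019, (7.6)] -/
def strongCoef (h : ℝ) (N k : ℕ) : ℝ := if k ≤ N then (hScale h k ^ 2)⁻¹ else 0

/-- `h₀(L)² = max(θ_max/δ₀, max(2^{d+3}θ_max², 8^dθ_max)/δ₁)`.
[cite: AdamsBuchholzKoteckyMuller2019, Theorem 7.1 (7.60)] -/
def hZeroSq (d R : ℕ) (δ₀ δ₁ : ℝ) : ℝ :=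
  max (thetaMax R d / δ₀) (max ((2 : ℝ) ^ (d + 3) * thetaMax R d ^ 2) ((8 : ℝ) ^ d * thetaMax R d) / δ₁)

/-- `h_k > 0`. [cite: AdamsBuchholzKoteckyMuller2019, (6.39)] -/
theorem hScale_pos {h : ℝ} (hh : 0 < h) (k : ℕ) : 0 < hScale h k := by unfold hScale; positivity

/-- `h_{k+1} = 2h_k`. [cite: AdamsBuchholzKoteckyMuller2019, (6.39)] -/
theorem hScale_succ (h : ℝ) (k : ℕ) : hScale h (k + 1) = 2 * hScale h k := by
  unfold hScale; rw [pow_succ]; ring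

/-- `h_0 = h`. [cite: AdamsBuchholzKoteckyMuller2019, (6.39)] -/
@[simp] theorem hScale_zero (h : ℝ) : hScale h 0 = h := by unfold hScale; simp

/-- `h_k² = 4^k h²`. [cite: AdamsBuchholzKoteckyMuller2019, (6.39)] -/
theorem hScale_sq (h : ℝ) (k : ℕ) : hScale h k ^ 2 = 4 ^ k * h ^ 2 := by
  unfold hScale; rw [mul_pow, ← pow_mul, mul_comm k 2, pow_mul]; norm_num

/-- `𝔥_k > 0`. [cite: AdamsBuchholzKoteckyMuller2019, (6.40)] -/
theorem fieldWt_pos {h L : ℝ} (hh : 0 < h) (hL : 0 < L) (d k : ℕ) : 0 < fieldWt h L d k := by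
  unfold fieldWt
  exact div_pos (hScale_pos hh k) (Real.sqrt_pos.2 (by positivity))

/-- `𝔥_k² (L^k)^{d-2} = h_k²`. [cite: AdamsBuchholzKoteckyMuller2019, (6.40)] -/
theorem fieldWt_sq_mul {h L : ℝ} (hL : 0 < L) (d k : ℕ) :
    fieldWt h L d k ^ 2 * (L ^ k) ^ (d - 2) = hScale h k ^ 2 := by
  unfold fieldWt
  have hp : (0 : ℝ) < L ^ (k * (d - 2)) := by positivity
  rw [div_pow, Real.sq_sqrt hp.le, ← pow_mul, div_mul_cancel₀ _ hp.ne']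

/-- `g_k ≥ 0`. [cite: AdamsBuchholzKoteckyMuller2019, (7.6)] -/
theorem strongCoef_nonneg (h : ℝ) (N k : ℕ) : 0 ≤ strongCoef h N k := by
  unfold strongCoef; split_ifs <;> positivity

/-- `g_k = h_k^{-2}` for `k ≤ N`. [cite: AdamsBuchholzKoteckyMuller2019, (7.6)] -/
theorem strongCoef_of_le {h : ℝ} {N k : ℕ} (hk : k ≤ N) : strongCoef h N k = (hScale h k ^ 2)⁻¹ := by
  unfold strongCoef; rw [if_pos hk]

/-- `1 ≤ θ_max`. [cite: AdamsBuchholzKoteckyMuller2019, (7.3)] -/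
theorem one_le_thetaMax (R d : ℕ) : 1 ≤ thetaMax R d := by
  unfold thetaMax; exact one_le_pow₀ (by exact_mod_cast Nat.succ_le_succ (Nat.zero_le _))

/-- `h₀² > 0`. [cite: AdamsBuchholzKoteckyMuller2019, Theorem 7.1 (7.60)] -/
theorem hZeroSq_pos (d R : ℕ) {δ₀ δ₁ : ℝ} (hδ₀ : 0 < δ₀) (_hδ₁ : 0 < δ₁) : 0 < hZeroSq d R δ₀ δ₁ :=
  lt_max_of_lt_left (div_pos (thetaMax_pos R d) hδ₀)

/-- Unpacking `h² ≥ h₀²`: `θ_max ≤ δ₀h²`, `2^{d+3}θ_max² ≤ δ₁h²`, `8^dθ_max ≤ δ₁h²`.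
[cite: AdamsBuchholzKoteckyMuller2019, Theorem 7.1 (7.60)] -/
theorem of_hZeroSq_le {d R : ℕ} {δ₀ δ₁ h : ℝ} (hδ₀ : 0 < δ₀) (hδ₁ : 0 < δ₁)
    (hh : hZeroSq d R δ₀ δ₁ ≤ h ^ 2) :
    thetaMax R d ≤ δ₀ * h ^ 2 ∧ (2 : ℝ) ^ (d + 3) * thetaMax R d ^ 2 ≤ δ₁ * h ^ 2 ∧
      (8 : ℝ) ^ d * thetaMax R d ≤ δ₁ * h ^ 2 := by
  have h1 : thetaMax R d / δ₀ ≤ h ^ 2 := le_trans (le_max_left _ _) hh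
  have h2 : max ((2 : ℝ) ^ (d + 3) * thetaMax R d ^ 2) ((8 : ℝ) ^ d * thetaMax R d) / δ₁ ≤ h ^ 2 :=
    le_trans (le_max_right _ _) hh
  rw [div_le_iff₀ hδ₀] at h1
  rw [div_le_iff₀ hδ₁, max_le_iff] at h2
  exact ⟨by linarith, by linarith [h2.1], by linarith [h2.2]⟩

/-- **(7.60): the strong forms are admissible**, `g_k ≤ δ'_k/θ_max` for all `k`, if `h ≥ h₀`.
[cite: AdamsBuchholzKoteckyMuller2019, Theorem 7.1 (7.60)] -/
theorem strongCoef_le {d R N : ℕ} {δ₀ δ₁ h : ℝ} (hδ₀ : 0 < δ₀) (hδ₁ : 0 < δ₁) (hh0 : 0 < h)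
    (hh : hZeroSq d R δ₀ δ₁ ≤ h ^ 2) (k : ℕ) :
    strongCoef h N k ≤ schedDelta δ₀ δ₁ N k / thetaMax R d := by
  obtain ⟨h1, h2, h3⟩ := of_hZeroSq_le hδ₀ hδ₁ hh
  have hθ := thetaMax_pos R d
  have hθ1 := one_le_thetaMax R d
  unfold strongCoef
  split_ifs with hk
  · rw [hScale_sq, le_div_iff₀ hθ]
    rcases Nat.eq_zero_or_pos k with rfl | hk0
    · rw [schedDelta_zero, pow_zero, one_mul]
      rw [inv_mul_le_iff₀ (by positivity)]
      linarith
    · rw [show k = (k - 1) + 1 by omega, schedDelta_succ, show k - 1 + 1 = k by omega, deltaSeq,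
        if_pos ⟨hk0, hk⟩]
      rw [inv_mul_le_iff₀ (by positivity)]
      have h4 : (4 : ℝ) ^ k ≠ 0 := by positivity
      have h8 : (1 : ℝ) ≤ 8 ^ d := one_le_pow₀ (by norm_num)
      have h8' : 1 * thetaMax R d ≤ 8 ^ d * thetaMax R d := mul_le_mul_of_nonneg_right h8 hθ.le
      calc thetaMax R d ≤ 1 * (δ₁ * h ^ 2) := by linarith
        _ = 4 ^ k * h ^ 2 * (δ₁ / 4 ^ k) := by field_simp
  · rw [le_div_iff₀ hθ, zero_mul]
    exact schedDelta_nonneg hδ₀.le hδ₁.le N k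

/-- **(7.62): the step condition of (w6')**, `2^{d+1} g_k θ_max² ≤ δ'_{k+1}` for `k + 1 ≤ N`, if
`h ≥ h₀`. [cite: AdamsBuchholzKoteckyMuller2019, Lemma 7.6 (7.62)] -/
theorem strong_step_cond {d R N : ℕ} {δ₀ δ₁ h : ℝ} (hδ₀ : 0 < δ₀) (hδ₁ : 0 < δ₁) (hh0 : 0 < h)
    (hh : hZeroSq d R δ₀ δ₁ ≤ h ^ 2) {k : ℕ} (hk : k + 1 ≤ N) :
    (2 : ℝ) ^ (d + 1) * strongCoef h N k * thetaMax R d ^ 2 ≤ schedDelta δ₀ δ₁ N (k + 1) := by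
  obtain ⟨-, h2, -⟩ := of_hZeroSq_le hδ₀ hδ₁ hh
  rw [strongCoef_of_le (by omega), hScale_sq, schedDelta_succ, deltaSeq, if_pos ⟨by omega, hk⟩,
    pow_succ, le_div_iff₀ (by positivity)]
  have h4 : (0 : ℝ) < 4 ^ k := by positivity
  calc (2 : ℝ) ^ (d + 1) * (4 ^ k * h ^ 2)⁻¹ * thetaMax R d ^ 2 * (4 ^ k * 4)
      = (2 : ℝ) ^ (d + 3) * thetaMax R d ^ 2 * (h ^ 2)⁻¹ := by
        field_simp; ring
    _ ≤ δ₁ * h ^ 2 * (h ^ 2)⁻¹ := by gcongr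
    _ = δ₁ := by field_simp

/-- **(7.87): the condition of Lemma 7.8 / (w9)**,
`8^d θ_max ≤ δ'_{k+1} 𝔥_{k+1}² (L^{k+1})^{d-2}` for `k + 1 ≤ N`, if `h ≥ h₀`.
[cite: AdamsBuchholzKoteckyMuller2019, Lemma 7.8 (7.87)] -/
theorem field_norm_cond {d R N : ℕ} {δ₀ δ₁ h L : ℝ} (hδ₀ : 0 < δ₀) (hδ₁ : 0 < δ₁) (hL : 0 < L)
    (hh : hZeroSq d R δ₀ δ₁ ≤ h ^ 2) {k : ℕ} (hk : k + 1 ≤ N) :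
    (8 : ℝ) ^ d * thetaMax R d ≤
      schedDelta δ₀ δ₁ N (k + 1) * fieldWt h L d (k + 1) ^ 2 * (L ^ (k + 1)) ^ (d - 2) := by
  obtain ⟨-, -, h3⟩ := of_hZeroSq_le hδ₀ hδ₁ hh
  rw [mul_assoc, fieldWt_sq_mul hL, hScale_sq, schedDelta_succ, deltaSeq, if_pos ⟨by omega, hk⟩]
  have h4 : (0 : ℝ) < 4 ^ (k + 1) := by positivity
  calc (8 : ℝ) ^ d * thetaMax R d ≤ δ₁ * h ^ 2 := h3
    _ = δ₁ / 4 ^ (k + 1) * (4 ^ (k + 1) * h ^ 2) := by field_simp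

end Literature.MathematicalPhysics.StatisticalMechanics.GradientRG

end
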